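import Literature.Barriers.CriticalPhenomena.PlaquetteWalkHoleRootWoundCostNS
import HarnessLib

/-!
# The cost of the class-`B2b` extension of a wound group

`Z → ∞` limit model of the printed Yang–Baxter weights (Glazman–Manolescu 2019, §1, eq. (1); `PlaquetteWalkAngleLimitCoefficient`:
`cost s l = n_{u₁} + n_{u₂} + (1 − slotDeg s)` counts the ISOLATED turns).  For a class-`B2a` walk `ω` from the hole root whose first
arc in the observed rhombus `r` TURNS (an `NS` group), Glazman–Manolescu's third group member `ext₃ ω` has one more arc inside `r`, from
the end side `ω.1` to the fourth side `z₃`.  This file computes its local configurations and its cost EXACTLY (the tree had the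
inequality `five_le_cost_ext₃`):

* `ΩG.kindsL_ext₃_of_ne` / `ΩG.kindsL_ext₃_self`: away from `r` the configurations are unchanged; at `r` the singleton `[k]` becomes the
  pair `[k, k]` (the new arc cuts the opposite corner, of the same kind);
* `ΩG.facesL_ext₃_perm`: the visited plaquettes are the same;
* ★★ `ΩG.isolatedTurns_ext₃`: `n_{u₁}(ext₃ ω) + n_{u₂}(ext₃ ω) + 1 = n_{u₁}(ω) + n_{u₂}(ω)`;
* ★★★ `ΩG.cost_ext₃_add_two`: `cost(ext₃ ω) + 2 = cost(ω) + 2·slotDeg(ω.1)` — the fourth side is slanted exactly when the end is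
  vertical;
* ★★★ `ΩG.cost_ext₃_eq_five_iff`: the extension is a LEVEL-`5` member iff `ω` is a cost-`5` walk ending on `N/S` or a cost-`7` walk
  ending on `E/W` — the «parents» of the level-`5` class-`B2b` members (exact census kit j276221/j280313, b-engine-1 g24: on the root row
  the cost-`7` parents are the `E`-slot classes `(n_{u₁}, n_{u₂}) = (3, 3)`, `q = ∓6`).
[GlazmanManolescu2019 Lemma 2.1 (proof: the groups of three walks), §1 Fig. 1, eq. (1), Remark 2.2; Glazman 2015 Lemma 3.1]
-/

noncomputable section

namespace Literature.Probability.RandomPlanarGeometry.SAW.YangBaxter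

open Real
open Literature.Barriers.CriticalPhenomena.PlaquetteWalk

open private IsNS ext₃_fst ext₃_snd_arcs z₃_spec fc_fh sides_distinctG returnSide_of_isB2a from
  Literature.Probability.RandomPlanarGeometry.YangBaxterSAWGeneralDomain

namespace ΩG

variable {D : Set Face} {w r : Face} {ω : ΩG D (w.side .W) r}

/-- Away from `r`, the two-arc extension has the same arc kinds in every plaquette. [cite: GlazmanManolescu2019, Lemma 2.1 (proof: the
groups of three walks); §1, Fig. 1] -/
theorem kindsL_ext₃_of_ne (hr : RootedFace D (w.side .W) r) (hN : IsNS ω hr) {f : Face} (hf : f ≠ r) :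
    kindsL (ω.ext₃ hr).2.mids f = kindsL ω.2.mids f := by
  have harcs : arcsOf (ω.ext₃ hr).2.mids = arcsOf ω.2.mids ++ [(r.side ω.1, r.side (ω.z₃ hr hN.1))] :=
    ext₃_snd_arcs ω hr hN
  have hface : arcFace (r.side ω.1, r.side (ω.z₃ hr hN.1)) = some r :=
    arcFace_side_side r _ _ (z₃_spec ω hr hN.1).2.2.symm
  unfold kindsL
  rw [harcs, List.filterMap_append, List.filterMap_cons, List.filterMap_nil, hface,
    if_neg (fun e => hf (Option.some.inj e).symm)]
  simp

/-- At `r`, the two-arc extension appends the kind of the new arc `ω.1 → z₃`. [cite: GlazmanManolescu2019, Lemma 2.1 (proof: the groups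
of three walks); §1, Fig. 1] -/
theorem kindsL_ext₃_self (hr : RootedFace D (w.side .W) r) (hN : IsNS ω hr) :
    kindsL (ω.ext₃ hr).2.mids r = kindsL ω.2.mids r ++ [arcKind ω.1 (ω.z₃ hr hN.1)] := by
  have hz := (z₃_spec ω hr hN.1).2.2
  have harcs : arcsOf (ω.ext₃ hr).2.mids = arcsOf ω.2.mids ++ [(r.side ω.1, r.side (ω.z₃ hr hN.1))] :=
    ext₃_snd_arcs ω hr hN
  have hface : arcFace (r.side ω.1, r.side (ω.z₃ hr hN.1)) = some r := arcFace_side_side r _ _ hz.symm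
  have hkind : arcKindOf (r.side ω.1, r.side (ω.z₃ hr hN.1)) = some (arcKind ω.1 (ω.z₃ hr hN.1)) := by
    simp [arcKindOf, hface, Face.sideOf_side]
  unfold kindsL
  rw [harcs, List.filterMap_append, List.filterMap_cons, List.filterMap_nil, hface, if_pos rfl, hkind]

/-- The two-arc extension visits the same plaquettes (as lists without repetition, up to order), provided `r` is already visited.
[cite: GlazmanManolescu2019, Lemma 2.1 (proof: the groups of three walks)] -/
theorem facesL_ext₃_perm (hr : RootedFace D (w.side .W) r) (hN : IsNS ω hr) (hmem : r ∈ facesL ω.2.mids) :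
    (facesL (ω.ext₃ hr).2.mids).Perm (facesL ω.2.mids) := by
  have harcs : arcsOf (ω.ext₃ hr).2.mids = arcsOf ω.2.mids ++ [(r.side ω.1, r.side (ω.z₃ hr hN.1))] :=
    ext₃_snd_arcs ω hr hN
  have hface : arcFace (r.side ω.1, r.side (ω.z₃ hr hN.1)) = some r :=
    arcFace_side_side r _ _ (z₃_spec ω hr hN.1).2.2.symm
  have hmem' : r ∈ (arcsOf ω.2.mids).filterMap arcFace := by
    unfold facesL at hmem; rwa [List.mem_dedup] at hmem
  unfold facesL
  rw [List.perm_ext_iff_of_nodup (List.nodup_dedup _) (List.nodup_dedup _)]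
  intro f
  rw [List.mem_dedup, List.mem_dedup, harcs, List.filterMap_append, List.filterMap_cons, List.filterMap_nil, hface,
    List.mem_append, List.mem_singleton]
  exact ⟨fun h => h.elim id (fun e => e ▸ hmem'), fun h => Or.inl h⟩

/-- The arc cutting the opposite corner of a rhombus has the same kind: if `{a, b}` and `{u, t}` partition the four sides and the arc
`a → b` is not straight, then `arcKind u t = arcKind a b`. [cite: GlazmanManolescu2019, §1, Fig. 1] -/
private theorem arcKind_opposite (a b u t : Side) (hk : arcKind a b ≠ .straight) (hab : a ≠ b) (hau : a ≠ u) (hbu : b ≠ u)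
    (hta : t ≠ a) (htb : t ≠ b) (htu : t ≠ u) : arcKind u t = arcKind a b := by
  cases a <;> cases b <;> cases u <;> cases t <;> simp_all (config := {decide := true})

/-- Counting over a list without repetition: two Boolean predicates that agree off one member `r`, false resp. true at `r`, have
counts differing by one. [folklore] -/
private theorem countP_succ_of_agree_off {L : List Face} (hL : L.Nodup) {r : Face} (hr : r ∈ L) {p q : Face → Bool}
    (hpq : ∀ f ∈ L, f ≠ r → p f = q f) (hp : p r = false) (hq : q r = true) : L.countP p + 1 = L.countP q := by
  have hperm := List.perm_cons_erase hr
  rw [hperm.countP_eq p, hperm.countP_eq q, List.countP_cons, List.countP_cons, hp, hq]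
  have hagree : (L.erase r).countP p = (L.erase r).countP q :=
    List.countP_congr fun f hf => by
      have hfr : f ≠ r := by
        intro e; subst e; exact (List.Nodup.not_mem_erase hL) hf
      rw [hpq f ((List.erase_subset) hf) hfr]
  rw [hagree]
  simp

/-- ★★ **THE EXTENSION LOSES EXACTLY ONE ISOLATED TURN**: for a class-`B2a` walk from the hole root whose first arc in `r` turns,
`n_{u₁}(ext₃ ω) + n_{u₂}(ext₃ ω) + 1 = n_{u₁}(ω) + n_{u₂}(ω)` — the plaquette `r`, an isolated turn of `ω` (`eq_firstHitG_of_fc_eq`: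
it carries only the first-crossing arc), becomes a doubly visited plaquette of the extension (the new arc cuts the opposite corner,
which has the same kind), and every other plaquette keeps its configuration. [cite: GlazmanManolescu2019, Lemma 2.1 (proof: the groups
of three walks); §1, Fig. 1 and eq. (1)] -/
theorem isolatedTurns_ext₃ (hr : RootedFace D (w.side .W) r) (h : ω.IsB2a)
    (hNS : arcKind (ω.2.sIn ω.2.firstHitG) (ω.2.sOut ω.2.firstHitG) ≠ .straight) :
    cfgCount (ω.ext₃ hr).2.mids [.corner] + cfgCount (ω.ext₃ hr).2.mids [.coCorner] + 1 =
      cfgCount ω.2.mids [.corner] + cfgCount ω.2.mids [.coCorner] := by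
  have hF := ω.fh_lt h
  obtain ⟨hfcF, hsInF, hsOutF⟩ := fc_fh ω hr h
  have hN : IsNS ω hr := ⟨h, by rw [← hsInF, ← hsOutF]; exact hNS⟩
  -- `r` is singly visited by `ω`: its configuration is the singleton `[k]`, `k` the kind of the first-crossing arc
  have hsv : ∀ j < ω.2.arcs.length, ω.2.fc j = ω.2.fc ω.2.firstHitG → j = ω.2.firstHitG :=
    fun j hj he => eq_firstHitG_of_fc_eq hr h hj he
  have hkr : kindsL ω.2.mids r = [arcKind (ω.2.sIn ω.2.firstHitG) (ω.2.sOut ω.2.firstHitG)] := by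
    have e := ω.2.kindsL_eq_singleton_of_single_visit hF hsv
    rwa [hfcF] at e
  have hmem : r ∈ facesL ω.2.mids := by
    have e := ω.2.fc_mem_facesL hF
    rwa [hfcF] at e
  -- the new arc has the same kind (it joins the two remaining sides: the opposite corner)
  have hz3 := z₃_spec ω hr h
  have hd := ω.2.sides_distinctG hr h.1
  rw [ω.returnSide_of_isB2a h] at hd
  have hs0 : ω.2.sIn ω.2.firstHitG ≠ ω.1 := by rw [hsInF]; exact fun e => hd.2.1 e.symm
  have hs1 : ω.2.sOut ω.2.firstHitG ≠ ω.1 := by rw [hsOutF]; exact fun e => hd.2.2 e.symm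
  have h10 : ω.2.sIn ω.2.firstHitG ≠ ω.2.sOut ω.2.firstHitG := ω.2.sIn_ne_sOut hF
  have hz0 : ω.z₃ hr h ≠ ω.2.sIn ω.2.firstHitG := by rw [hsInF]; exact hz3.1
  have hz1 : ω.z₃ hr h ≠ ω.2.sOut ω.2.firstHitG := by rw [hsOutF]; exact hz3.2.1
  have hz2 : ω.z₃ hr h ≠ ω.1 := hz3.2.2
  have hsame : arcKind ω.1 (ω.z₃ hr h) = arcKind (ω.2.sIn ω.2.firstHitG) (ω.2.sOut ω.2.firstHitG) :=
    arcKind_opposite _ _ _ _ hNS h10 hs0 hs1 hz0 hz1 hz2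
  have hkr' : kindsL (ω.ext₃ hr).2.mids r =
      [arcKind (ω.2.sIn ω.2.firstHitG) (ω.2.sOut ω.2.firstHitG), arcKind (ω.2.sIn ω.2.firstHitG) (ω.2.sOut ω.2.firstHitG)] := by
    rw [kindsL_ext₃_self hr hN, hkr, hsame]; rfl
  -- the kind `k` of the first-crossing arc is a corner or a co-corner
  have hkc : arcKind (ω.2.sIn ω.2.firstHitG) (ω.2.sOut ω.2.firstHitG) = .corner ∨
      arcKind (ω.2.sIn ω.2.firstHitG) (ω.2.sOut ω.2.firstHitG) = .coCorner := by
    revert hNS h10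
    cases ω.2.sIn ω.2.firstHitG <;> cases ω.2.sOut ω.2.firstHitG <;> decide
  -- count over the same plaquettes
  have hperm := facesL_ext₃_perm hr hN hmem
  have hnd : (facesL ω.2.mids).Nodup := List.nodup_dedup _
  have hoff : ∀ κ : List ArcKind, ∀ f ∈ facesL ω.2.mids, f ≠ r →
      (decide (kindsL (ω.ext₃ hr).2.mids f = κ)) = decide (kindsL ω.2.mids f = κ) := by
    intro κ f _ hf; rw [kindsL_ext₃_of_ne hr hN hf]
  have hall : ∀ κ : List ArcKind, decide (kindsL (ω.ext₃ hr).2.mids r = κ) = decide (kindsL ω.2.mids r = κ) →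
      (facesL ω.2.mids).countP (fun f => decide (kindsL (ω.ext₃ hr).2.mids f = κ)) =
        (facesL ω.2.mids).countP (fun f => decide (kindsL ω.2.mids f = κ)) := by
    intro κ hκ
    exact List.countP_congr fun f hf => by
      by_cases hfr : f = r
      · rw [hfr, hκ]
      · rw [hoff κ f hf hfr]
  unfold cfgCount
  rw [hperm.countP_eq, hperm.countP_eq]
  rcases hkc with e | e
  · have h1 := countP_succ_of_agree_off hnd hmem (hoff [.corner]) (by rw [hkr', e]; decide) (by rw [hkr, e]; decide)
    have h2 := hall [.coCorner] (by rw [hkr', hkr, e]; decide)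
    omega
  · have h1 := countP_succ_of_agree_off hnd hmem (hoff [.coCorner]) (by rw [hkr', e]; decide) (by rw [hkr, e]; decide)
    have h2 := hall [.corner] (by rw [hkr', hkr, e]; decide)
    omega

/-- The two sides of a rhombus left free by a turning arc are again one vertical and one slanted side: their slot degrees add up
to `1`. [cite: GlazmanManolescu2019, §1, Fig. 1; Lemma 2.1, eq. (CR)] -/
private theorem slotDeg_opposite (a b u t : Side) (hk : arcKind a b ≠ .straight) (hab : a ≠ b) (hau : a ≠ u) (hbu : b ≠ u)
    (hta : t ≠ a) (htb : t ≠ b) (htu : t ≠ u) : slotDeg (slotOfSide t) + slotDeg (slotOfSide u) = 1 := by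
  cases a <;> cases b <;> cases u <;> cases t <;> simp_all (config := {decide := true})

/-- ★★★ **THE COST OF THE EXTENSION**: `cost(ext₃ ω) + 2 = cost(ω) + 2·slotDeg(ω.1)` for a class-`B2a` walk from the hole root whose
first arc in `r` turns — one isolated turn is lost (`isolatedTurns_ext₃`) and the fourth side `z₃` is slanted exactly when the end
`ω.1` is vertical (`slotDeg z₃ + slotDeg ω.1 = 1`).  So the extension costs `cost ω` when `ω` ends on `N/S` and `cost ω − 2` when it
ends on `E/W`. [cite: GlazmanManolescu2019, Lemma 2.1 (proof: the groups of three walks); §1, Fig. 1 and eq. (1); Remark 2.2]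
[cite: Glazman2015WeightedSAW, Lemma 3.1 (proof, pp. 6–7)] -/
theorem cost_ext₃_add_two (hr : RootedFace D (w.side .W) r) (h : ω.IsB2a)
    (hNS : arcKind (ω.2.sIn ω.2.firstHitG) (ω.2.sOut ω.2.firstHitG) ≠ .straight) :
    cost (slotOfSide (ω.ext₃ hr).1) (ω.ext₃ hr).2.mids + 2 = cost (slotOfSide ω.1) ω.2.mids + 2 * slotDeg (slotOfSide ω.1) := by
  have hF := ω.fh_lt h
  obtain ⟨-, hsInF, hsOutF⟩ := fc_fh ω hr h
  have hN : IsNS ω hr := ⟨h, by rw [← hsInF, ← hsOutF]; exact hNS⟩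
  have hfst : (ω.ext₃ hr).1 = ω.z₃ hr h := ext₃_fst ω hr hN
  have hiso := isolatedTurns_ext₃ hr h hNS
  have hz3 := z₃_spec ω hr h
  have hd := ω.2.sides_distinctG hr h.1
  rw [ω.returnSide_of_isB2a h] at hd
  have hs0 : ω.2.sIn ω.2.firstHitG ≠ ω.1 := by rw [hsInF]; exact fun e => hd.2.1 e.symm
  have hs1 : ω.2.sOut ω.2.firstHitG ≠ ω.1 := by rw [hsOutF]; exact fun e => hd.2.2 e.symm
  have h10 : ω.2.sIn ω.2.firstHitG ≠ ω.2.sOut ω.2.firstHitG := ω.2.sIn_ne_sOut hF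
  have hz0 : ω.z₃ hr h ≠ ω.2.sIn ω.2.firstHitG := by rw [hsInF]; exact hz3.1
  have hz1 : ω.z₃ hr h ≠ ω.2.sOut ω.2.firstHitG := by rw [hsOutF]; exact hz3.2.1
  have hz2 : ω.z₃ hr h ≠ ω.1 := hz3.2.2
  have hsd := slotDeg_opposite _ _ _ _ hNS h10 hs0 hs1 hz0 hz1 hz2
  have hslot : slotDeg (slotOfSide (ω.ext₃ hr).1) = slotDeg (slotOfSide (ω.z₃ hr h)) := by rw [hfst]
  unfold cost
  rw [hslot]
  omega

/-- ★★★ **THE PARENTS OF THE LEVEL-`5` CLASS-`B2b` MEMBERS**: the extension `ext₃ ω` of a class-`B2a` walk from the hole root whose first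
arc in `r` turns is a level-`5` member (`cost = 5`) iff `ω` is a cost-`5` walk ending on a slanted side (`N`/`S`) of `r` or a cost-`7`
walk ending on a vertical side (`E`/`W`).  (Exact census kit j276221 / j280313, b-engine-1 g24: on the root row the cost-`7` parents are
the `E`-slot classes with `(n_{u₁}, n_{u₂}) = (3, 3)`, `n_w = 0`, `q = ∓6`.) [cite: GlazmanManolescu2019, Lemma 2.1 (proof: the groups
of three walks); §1, Fig. 1 and eq. (1); Remark 2.2] [cite: Glazman2015WeightedSAW, Lemma 3.1 (proof, pp. 6–7)] -/
theorem cost_ext₃_eq_five_iff (hr : RootedFace D (w.side .W) r) (h : ω.IsB2a)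
    (hNS : arcKind (ω.2.sIn ω.2.firstHitG) (ω.2.sOut ω.2.firstHitG) ≠ .straight) :
    cost (slotOfSide (ω.ext₃ hr).1) (ω.ext₃ hr).2.mids = 5 ↔
      (cost (slotOfSide ω.1) ω.2.mids = 5 ∧ (ω.1 = .N ∨ ω.1 = .S)) ∨
        (cost (slotOfSide ω.1) ω.2.mids = 7 ∧ (ω.1 = .E ∨ ω.1 = .W)) := by
  have h2 := cost_ext₃_add_two hr h hNS
  have key : ∀ u : Side, (slotDeg (slotOfSide u) = 1 ∧ (u = .N ∨ u = .S) ∧ ¬(u = .E ∨ u = .W)) ∨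
      (slotDeg (slotOfSide u) = 0 ∧ ¬(u = .N ∨ u = .S) ∧ (u = .E ∨ u = .W)) := by
    intro u; cases u <;> decide
  rcases key ω.1 with ⟨hd, hy, hn⟩ | ⟨hd, hn, hy⟩
  · rw [hd] at h2
    constructor
    · intro h5; exact Or.inl ⟨by omega, hy⟩
    · rintro (⟨h5, -⟩ | ⟨-, hu⟩)
      · omega
      · exact absurd hu hn
  · rw [hd] at h2
    constructor
    · intro h5; exact Or.inr ⟨by omega, hy⟩
    · rintro (⟨-, hu⟩ | ⟨h7, -⟩)
      · exact absurd hu hn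
      · omega

end ΩG

end Literature.Probability.RandomPlanarGeometry.SAW.YangBaxter
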